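/- Copyright: the b2b-balaban cell (near-miss cell 7), T⁴-continuum fan-out; row NE7b CRUX team (2), seat
t4-ne7b-formalise-leaf-03 (gen 28) — custodian's D-50-2′ «THE WEIGHTED PLUG CHAIN», part 4 of the chain: the (α) assembly over
the plug record `HistReadDataLP` (§1), the embedding of the OWNER's L4 record `HistReadDataL` into it with L5 §1 RE-DERIVED
through the chain (§2), and the terminal theorem (§3).  Released under the licence of the surrounding project. -/
import Summits.QuantumFields.BalabanUV.T4Continuum.Support.HistoryRealiseCellsRunAssemblyWTVSDataLP
import Summits.QuantumFields.BalabanUV.T4Continuum.Support.HistoryRealiseCellsRunSupplyWTVSW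
import Summits.QuantumFields.BalabanUV.T4Continuum.Support.HistoryRealiseCellsRunAssemblyWTVSL

/-!
# THE (α) ASSEMBLY OVER THE PLUG RECORD: `HistReadDataLP` ⇒ `Nonempty (CountRoadWitnessT3bWTVSL …)` AT THE LEDGER's WEIGHT,
# `HistReadDataL.toLP` (M5-2c instance) WITH L5 §1 RE-DERIVED, AND THE TERMINAL THEOREM
# (D-50-2′ part 4; re-open object (α) of row NE7b; custodian lineage `t4-ne7b-formalise-leaf-03` gen 28)

Summits-side support leaf of the T⁴-continuum cell (rung (B)+1 on a FINITE torus only; NOT infinite volume, NOT the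
mass gap, NOT the Clay statement; NOT a proof of the spine estimate NE7b — the cell's OWN estimate, NOT PRINTED, NOT
PROVED).  [folklore] composition BY NAME: §1 is L5 §1's term (`HistoryRealiseCellsRunAssemblyWTVSL`, p287559) with the
witness's `FcM`∕`FcM′`∕`uV` at the record's weight `wV K`, `upM := upM_of_reading'_of_plug … (hplug K hK)` (part 2),
`priceM`∕`priceM′ := priceM_of_reading_w` (part 2), `upM′` through `LIVEOf_mono_const … (hwV K hK)` on the record's `upB`
(booked at `2^{d+3}`); every other junction VERBATIM.  §2 one `def` (`HistReadDataL.toLP`: the ten M5-2c volume fields ⇒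
`wV := 2^{d+3}`, `hplug := plug_of_flat` per term, `huV` verbatim) + L5 §1's CONCLUSION re-derived as §1 ∘ `toLP`.  §3 the
terminal theorem = L5 §2 with `HistReadDataL ↦ HistReadDataLP`.  No `[cite:]` tag, nothing printed asserted, no `Prop`
fact minted, zero `sorry`.

WHY (F-ne7bleaf03g28-1; R-OWNER-51-1 (5) «D-50-2»).  With §1 the (α) assembly is LEDGER-AGNOSTIC: M5-2c enters through
§2's `toLP`, M5-2d ∕ M5-2e through the embeddings of `HistReadDataLW` at their weights and windows (part 5, ON EVENT (E5) +
leaf-06 IR-51-1) — the terminal theorem of record can then be re-run on the per-level dead-box ledger without touching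
§1 again.  §2's re-derivation is the kernel's certificate that the plug road is a CONSERVATIVE generalisation of L4∕L5.

BY-NAME EFFECT (`WALL-NE7b-P1.md` §2): none on classes — «volume calibrations» ∕ (WS1) ∕ `RoundingRoomF` stay K modulo
PREFIX + C-side exactly as booked; what changes is WHICH ledger the terminal theorem can consume.  HONEST SCOPE.
CONDITIONAL on everything the record displays; nothing of Bałaban's discharged; NE7b NOT proved; spine 0∕9.  HONEST
DEPENDENCY (cell): continuum YM on T⁴ ⇐ BetaPertH ∧ nine spine estimates (0/9 proved); BetaPertH ⇐ (D1) ∧ (D4) ∧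
CAP+tail; G-an2-4 gates asym, D1 and NE2/3/4.  This file changes none of it.
-/
open Finset MeasureTheory
open Literature.MathematicalPhysics.QuantumFieldTheory.Balaban1983to89
open T4PersistenceDictionary T4PersistentHistoryCount T4BankedInduction T4PrintedShapeBanking
open T4WeightBudget T4GlobalDenominator T4LiveClassFibration T4LiveStructureGas T4LiveGasToTerms T4RecordPriceSeam
open T4PartnerMultiplicity T4IndicatorShell T4MatchingAssembly T4MatchingClosure T4MatchingClosureSocket T4Continuum
open T4StabilitySocket T4BranchingRecordsGas T4TaggedShapeBanking T4CanonicalMenus T4RenewalChains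
open Summit.QuantumFields.BalabanUV.T4Continuum.PlacementBatch Summit.QuantumFields.BalabanUV.T4Continuum.PlacementSkeleton
open Summit.QuantumFields.BalabanUV.T4Continuum.CountThresholdUniform Summit.QuantumFields.BalabanUV.T4Continuum.CountThresholdExit
open Summit.QuantumFields.BalabanUV.T4Continuum.CountSeamJunction Summit.QuantumFields.BalabanUV.T4Continuum.LateMergers
open Summit.QuantumFields.BalabanUV.T4Continuum.HistoryFlow Summit.QuantumFields.BalabanUV.T4Continuum.HistoryRegeneration
open Summit.QuantumFields.BalabanUV.T4Continuum.HistoryTables Summit.QuantumFields.BalabanUV.T4Continuum.HistoryAssemblyTrees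
open Summit.QuantumFields.BalabanUV.T4Continuum.HistoryAssemblyTerms Summit.QuantumFields.BalabanUV.T4Continuum.HistoryAssemblyPedigree
open Summit.QuantumFields.BalabanUV.T4Continuum.HistoryConstants Summit.QuantumFields.BalabanUV.T4Continuum.HistoryGen
open Literature.MathematicalPhysics.QuantumFieldTheory.Balaban1983to89.B13ScaleTransfer
open Summit.QuantumFields.BalabanUV.T4Continuum.ZoneSkeleton Summit.QuantumFields.BalabanUV.T4Continuum.HistorySocketTH
open Summit.QuantumFields.BalabanUV.T4Continuum.HistoryCaps Summit.QuantumFields.BalabanUV.T4Continuum.HistoryAssemblyPrice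
open Summit.QuantumFields.BalabanUV.T4Continuum.HistoryBankingLE Summit.QuantumFields.BalabanUV.T4Continuum.HistoryExitLE
open Summit.QuantumFields.BalabanUV.T4Continuum.HistoryAssemblyTreesLE Summit.QuantumFields.BalabanUV.T4Continuum.HistoryAssemblyTermsLE
open Summit.QuantumFields.BalabanUV.T4Continuum.HistoryRealise Summit.QuantumFields.BalabanUV.T4Continuum.HistoryAssemblyRealiseLE
open Summit.QuantumFields.BalabanUV.T4Continuum.HistoryAssemblyMult Summit.QuantumFields.BalabanUV.T4Continuum.HistoryAssemblyMultKey
open Summit.QuantumFields.BalabanUV.T4Continuum.HistoryAssemblyRealiseRun Summit.QuantumFields.BalabanUV.T4Continuum.HistoryAssemblyRealiseMult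
open Summit.QuantumFields.BalabanUV.T4Continuum.HistoryZones Summit.QuantumFields.BalabanUV.T4Continuum.HistoryRealiseCells
open Summit.QuantumFields.BalabanUV.T4Continuum.HistoryRealiseCellsRun Summit.QuantumFields.BalabanUV.T4Continuum.HistoryAssemblyRealiseRunMult
open Summit.QuantumFields.BalabanUV.T4Continuum.HistoryRealiseCellsRunMult Summit.QuantumFields.BalabanUV.T4Continuum.HistoryAssemblyMultInstance
open Summit.QuantumFields.BalabanUV.T4Continuum.HistoryJoinsPlacedMember Summit.QuantumFields.BalabanUV.T4Continuum.PlacementSkeleton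
open Summit.QuantumFields.BalabanUV.T4Continuum.HistoryJoinsPlacedMult Summit.QuantumFields.BalabanUV.T4Continuum.HistoryRealiseDistinct
open Summit.QuantumFields.BalabanUV.T4Continuum.HistoryRegionTemplates Summit.QuantumFields.BalabanUV.T4Continuum.HistoryCaps
open Summit.QuantumFields.BalabanUV.T4Continuum.HistoryZoneEvolve (cth)
open Literature.MathematicalPhysics.QuantumFieldTheory.Balaban1983to89.B16SProfile (DropCtl)
open Summit.QuantumFields.BalabanUV.T4Continuum.HistoryRealiseCellsRunMultEnd Summit.QuantumFields.BalabanUV.T4Continuum.HistoryRealiseCellsRunMultEndD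
open Summit.QuantumFields.BalabanUV.T4Continuum.HistoryRealiseCellsRunPinnedT3b Summit.QuantumFields.BalabanUV.T4Continuum.HistoryHybridRescale
open Summit.QuantumFields.BalabanUV.T4Continuum.HistoryRealiseCellsRunApex (exists_const_schemeZ)
open Summit.QuantumFields.BalabanUV.T4Continuum.HistoryRealisePrint Summit.QuantumFields.BalabanUV.T4Continuum.HistoryRealiseWeak
open Summit.QuantumFields.BalabanUV.T4Continuum.HistoryRealisePrintReading Summit.QuantumFields.BalabanUV.T4Continuum.HistoryRealiseWeakReading
open Summit.QuantumFields.BalabanUV.T4Continuum.HistoryRealisePrintCells Summit.QuantumFields.BalabanUV.T4Continuum.HistoryRealiseWeakCells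
open Summit.QuantumFields.BalabanUV.T4Continuum.HistoryRealiseCellsRunApexT3b Summit.QuantumFields.BalabanUV.T4Continuum.HistoryRealiseCellsRunApexT3bW

open Summit.QuantumFields.BalabanUV.T4Continuum.HistoryRealiseCellsRunApexT3bWT Summit.QuantumFields.BalabanUV.T4Continuum.HistoryRealiseCellsRunPinnedT3bWT
open Summit.QuantumFields.BalabanUV.T4Continuum.HistoryRealiseCellsRunHeadlineT3bWT
open Summit.QuantumFields.BalabanUV.T4Continuum.HistoryRealiseCellsRunApexT3bWTV Summit.QuantumFields.BalabanUV.T4Continuum.HistoryBankingVolumePlug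
open Summit.QuantumFields.BalabanUV.T4Continuum.HistoryRealiseCellsRunApexT3bWTVS
open Summit.QuantumFields.BalabanUV.T4Continuum.HistoryGenealogyRealise
open Summit.QuantumFields.BalabanUV.T4Continuum.HistoryGenealogyInstantiate
open Summit.QuantumFields.BalabanUV.T4Continuum.B16HistoryIndexedRepr
open Summit.QuantumFields.BalabanUV.T4Continuum.HistoryBankingDiscountCharge
open Summit.QuantumFields.BalabanUV.T4Continuum.HistoryBankingCreditRead
open Summit.QuantumFields.BalabanUV.T4Continuum.HistoryBankingFibreRoom
open Summit.QuantumFields.BalabanUV.T4Continuum.HistoryPriceKeys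
open Summit.QuantumFields.BalabanUV.T4Continuum.HistoryRealiseCellsRunSupplyWTVS
open Summit.QuantumFields.BalabanUV.T4Continuum.HistoryRealiseCellsRunSupplyKeysWTVS
open Summit.QuantumFields.BalabanUV.T4Continuum.HistoryRealiseCellsRunAssemblyWTVSData
open Summit.QuantumFields.BalabanUV.T4Continuum.HistoryRealiseWeakCells
open Summit.QuantumFields.BalabanUV.T4Continuum.B16HistoryIndexedTrunc
open Summit.QuantumFields.BalabanUV.T4Continuum.HistoryRealiseCellsRunAssemblyWTVSDataL
open Summit.QuantumFields.BalabanUV.T4Continuum.HistoryRealiseCellsRunApexT3bWTVSL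
open Summit.QuantumFields.BalabanUV.T4Continuum.HistoryRealiseCellsRunHeadlineT3bPWTVSL

open Summit.QuantumFields.BalabanUV.T4Continuum.HistoryBankingForestVolume
open Summit.QuantumFields.BalabanUV.T4Continuum.B16HistoryWeightPlugW
open Summit.QuantumFields.BalabanUV.T4Continuum.HistoryRealiseCellsRunSupplyWTVSW
open Summit.QuantumFields.BalabanUV.T4Continuum.HistoryRealiseCellsRunAssemblyWTVSDataLP
open Summit.QuantumFields.BalabanUV.T4Continuum.HistoryRealiseCellsRunAssemblyWTVSL

namespace Summit.QuantumFields.BalabanUV.T4Continuum.HistoryRealiseCellsRunAssemblyWTVSLP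

noncomputable section

set_option synthInstance.maxSize 1024

section Assembly

variable {F : T4Family} {G : Type*} [GaugeGroup G] [MeasurableSpace G] [HaarData G] [RegularGaugeGroup G]

omit [RegularGaugeGroup G] in
/-- **THE (α) ASSEMBLY OVER THE PLUG RECORD** (D-50-2′): from `HistReadDataLP` (data + located displays, the volume ledger a
plug at the displayed weight `wV`), `Nonempty (CountRoadWitnessT3bWTVSL D C O θᵥ rr d n hn g₀ os (HIndex.Idx I) (ℕ × Lab d) (Lab d))` —
L5 §1's term with `FcM`∕`FcM′`∕`uV` at `wV K`, `upM := upM_of_reading'_of_plug … hplug`, `priceM := priceM_of_reading_w`, `upM′`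
by `LIVEOf_mono_const … hwV` on `upB`. [folklore] -/
theorem nonempty_countRoadWitnessT3bWTVSL_of_histReadingLP {D : FiniteEpsData F G} {C : T4PrintedShapeBanking.Consts}
    {O : PrintedO1s} {θv : ℝ} {rr d n : ℕ} {hn : 0 < n} {g₀ : ℕ → ℝ} {os : List (ULoop F)} {DomK : ℕ → Type}
    {I : (K : ℕ) → HIndex (DomK K)} [DecidableEq (HIndex.Idx I)] {DomK' : ℕ → Type} {I' : (K : ℕ) → HIndex (DomK' K)}
    {X : ℕ → Type} [∀ K, MeasurableSpace (X K)] {μ : (K : ℕ) → Measure (X K)} [∀ K, IsFiniteMeasure (μ K)]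
    {𝒢 : (K : ℕ) → GoodClass (X K)} {Y : ℕ → Type} [∀ K, MeasurableSpace (Y K)] {νB : (K : ℕ) → Measure (Y K)}
    [∀ K, IsFiniteMeasure (νB K)] {𝒢' : (K : ℕ) → GoodClass (Y K)}
    (Dd : HistReadDataLP D C O θv rr d n hn g₀ os I I' X μ 𝒢 Y νB 𝒢') :
    Nonempty (CountRoadWitnessT3bWTVSL D C O θv rr d n hn g₀ os (HIndex.Idx I) (ℕ × Lab d) (Lab d)) := by
  obtain ⟨l₀, vol, l₀_pos, vol_pos, K₀, RA, ρA, holdsA, intA, H2A, ℛ, hL, hs, Φf, hR, isRj, one_le_R, hL4, hprof, hdrop,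
    hN, hRm, hRmS, hRm2, hD, hreg, hn₁, hE₂, hE₃, wV, hwV, hplug, sB, sR, φB, φR, β', β₀,
    hF, hRR, h29, huV, W, one_le_W, Wi, BAi, mi, hWi, hBA, hmi, hρ, c₀, n₁, c₀_pos, floor, floor', sites, sites', RB, ρB,
    holdsB, intB, H2B, trunc, htr, dB, mup, sB', φB', sR', φR', hRR', upB, deadB_nonneg, resumB, mup_bd, shA, shB,
    Wsh, shell, Cc, Rr, CcRec, RrRec, ν, u, s₂, q₀, r, s, budget, sum_r, sum_u, sum_s, sum_s₂⟩ := Dd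
  -- the flow's letters at the reading
  have hL0 : 0 < F.L := lt_of_lt_of_le (by norm_num) (two_le_L F)
  have hL1 : 1 ≤ F.L := le_trans (by norm_num) (two_le_L F)
  have hL0' : 0 < ℛ.L := by rw [hL]; exact hL0
  have hL4' : 4 ≤ ℛ.L := by rw [hL]; exact hL4
  have hdrop' : ∀ K, K₀ ≤ K → ∀ m, DropCtl (ℛ.s K) m := by rw [hs]; exact hdrop
  have hWpos : ∀ K, 0 < W K := fun K => lt_of_lt_of_le one_pos (one_le_W K)
  have hmass : ∀ K, 0 ≤ (μ K).real Set.univ := fun K => measureReal_nonneg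
  -- PLUG 1 (the cut): the junction's box input READ OFF the input display `RegionsInBox`
  have hbox : ∀ K, K₀ ≤ K → ∀ τ ∈ HIndex.termSet I K, (ℛ.inputOf.run K τ).InBoxOK n K := fun K hK τ hτ =>
    RunInputM.inBoxOK_of_regionsInBox (hN K hK τ hτ) (hreg K hK τ hτ)
  -- (c3): `realised` first (JunctionV, transported along (c1)'s equations), then the root-cell injectivity
  have realised : RealisedDomainsRW F.L (runProfile F.L ℛ.R) n K₀ ℛ.R (HIndex.termSet I) ℛ.inputOf.pedV
      (fun _ _ => id) ℛ.inputOf.liveCV ℛ.inputOf.ZV := by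
    have h0 : RealisedDomainsRW ℛ.L ℛ.s n K₀ ℛ.R (HIndex.termSet I) ℛ.inputOf.pedV (fun _ _ => id) ℛ.inputOf.liveCV
        ℛ.inputOf.ZV :=
      ℛ.inputOf.realisedDomainsRW_of_familyV (HIndex.termSet I) n K₀ hN hRm hRmS hRm2 hD hL0' hbox
    rw [hL, hs] at h0
    exact h0
  have hinj : ∀ K, K₀ ≤ K → ∀ τ ∈ HIndex.termSet I K,
      Set.InjOn (cellOfR n F.L (runProfile F.L ℛ.R) ℛ.inputOf.pedV (fun _ _ => id) K τ)
        (ℛ.inputOf.liveCV K τ : Set (ℕ × Lab d)) :=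
    fun K hK τ hτ => cellOfR_injOn_W hL0 realised hK (hprof K hK) (hdrop K hK K) hτ
  -- PLUG 3 (the cut): `boxedBirths` PROVED of the reading from `hreg` (IR-47-1′ PART 3), transported along (c1) like `realised`
  have hBB : ∀ K, K₀ ≤ K → ∀ τ ∈ HIndex.termSet I K, ∀ c ∈ ℛ.inputOf.liveCV K τ,
      BoxedBirths n F.L K (levelOf (runProfile F.L ℛ.R K) K) ((ℛ.inputOf.pedV K τ).toPGen id c) := by
    have h0 : ∀ K, K₀ ≤ K → ∀ τ ∈ HIndex.termSet I K, ∀ c ∈ ℛ.inputOf.liveCV K τ,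
        BoxedBirths n ℛ.L K (levelOf (ℛ.s K) K) ((ℛ.inputOf.pedV K τ).toPGen id c) :=
      ℛ.inputOf.boxedBirths_pedV (HIndex.termSet I) n K₀ hN hRm hRmS hRm2 hD hL0' hreg
    rw [hL, hs] at h0
    exact h0
  -- D-50-2′: run B's numerator display re-weighted from `2^{d+3}` to `wV K` (`LIVEOf_mono_const`, `dB ≥ 0`, `mup ≥ 0`)
  have hupB : ∀ K t, |t| ≤ l₀ → K₀ ≤ K →
      ∀ k ∈ badGMems (memA n F.L ℛ) jhalf (HIndex.termSet I)
          (kmemA n F.L hn (lt_of_lt_of_le (by norm_num) (two_le_L F)) ℛ) K,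
        ∀ τ' ∈ HIndex.termSet I' (K + 1),
          trunc K τ' ∈ fibre (kmemA n F.L hn (lt_of_lt_of_le (by norm_num) (two_le_L F)) ℛ) (HIndex.termSet I) K k →
            Repr172R.weight νB RB t τ' ≤
              dB K t τ' * LIVEOf C K (ℛ.R K) (fun m => wV K * Real.log (Φf.Λ K m)) (sharpT (sB' K) (sR' K)) k *
                mup K t :=
    fun K t ht hK k hk τ' hτ' hf => (upB K t ht hK k hk τ' hτ' hf).trans
      (mul_le_mul_of_nonneg_right
        (mul_le_mul_of_nonneg_left
          (LIVEOf_mono_const C K (ℛ.R K) (hwV K hK) (fun m => Real.log_nonneg (Φf.one_le_Λ K m)) _ k)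
          (deadB_nonneg K t ht hK k hk τ' hτ' hf))
        (mup_bd K t ht hK).1)
  refine ⟨{
    l₀ := l₀, vol := vol, l₀_pos := l₀_pos, vol_pos := vol_pos, K₀ := K₀, T := HIndex.termSet I,
    A := fun _ t => Repr172R.weight μ RA t, A' := weightB νB RB trunc, shA := shA, shB := shB,
    dead := fun K t τ => deadOf ℛ Φf W K t τ, dead' := aggW trunc (fun K => HIndex.termSet I' (K + 1)) dB,
    nup := nupOf Φf (fun K => (μ K).real Set.univ) W, mup := mup, Nup := Real.exp BAi * mi * Wi,
    Cc := Cc, Rr := Rr, CcRec := CcRec, RrRec := RrRec, ν := ν, u := u, s₂ := s₂, q₀ := q₀, r := r, s := s, Wsh := Wsh,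
    reprA := fun K t ht hK =>
      (H2A K t ht hK).trans (Repr172R.integral_eq_sum_weight μ RA K t (ρA K t) (holdsA K t) (intA K t)),
    reprB := fun K t ht hK =>
      (H2B K t ht hK).trans (reprB_of_holds_trunc νB RB trunc K (fun t => ∫ y, ρB K t y ∂νB (K + 1)) (ρB K)
        (fun _ => rfl) (holdsB K) (intB K) (htr K hK) t),
    c₀ := c₀, n₁ := n₁, c₀_pos := c₀_pos, floor := floor, floor' := floor', sites := sites, sites' := sites',
    Nup_nonneg := mul_nonneg (mul_nonneg (Real.exp_pos _).le ((hmass 0).trans (hmi 0)))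
      (zero_le_one.trans ((one_le_W 0).trans (hWi 0))),
    nup_bd := fun K t ht hK => ⟨nupOf_measure_nonneg Φf μ (fun K => (hWpos K).le) K t,
      nupOf_le Φf (hmass K) (hWpos K).le (hBA K t ht hK) (hmi K) (hWi K)⟩,
    mup_bd := mup_bd, R := ℛ.R, isRj := isRj, one_le_R := one_le_R,
    ped := ℛ.inputOf.pedV, cellP := fun _ _ => id, liveC := ℛ.inputOf.liveCV, Zd := ℛ.inputOf.ZV,
    realised := realised,
    step_le := fun K _ τ _ c hc => by
      obtain ⟨x, -, rfl⟩ := Finset.mem_image.1 hc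
      exact le_rfl,
    -- PLUG 2 (the cut): the GUARDED join display PROVED of the reading on pass V (IR-47-1′ PART 3); PLUG 3
    disjointJoins := ℛ.inputOf.disjointJoinsL_pedV (HIndex.termSet I) K₀ hN hRm hRmS hRm2 hD hL0',
    boxedBirths := hBB,
    FcM := fun K k => LIVEOf C K (ℛ.R K) (fun m => wV K * Real.log (Φf.Λ K m)) (sharpT (sB K) (sR K)) k,
    RfM := fun K k => MULTOf (sharpT (φB K) (φR K)) k,
    FcM' := fun K k => LIVEOf C K (ℛ.R K) (fun m => wV K * Real.log (Φf.Λ K m)) (sharpT (sB' K) (sR' K)) k,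
    RfM' := fun K k => MULTOf (sharpT (φB' K) (φR' K)) k,
    uV := fun K m => wV K * Real.log (Φf.Λ K m), huV := huV,
    priceM := fun K t _ hK τ hτ =>
      priceM_of_reading_w ℛ (hN K hK) (hRm K hK) (hRmS K hK) (hRm2 K hK) (hD K hK) hL0' hL4' (hdrop' K hK)
        (one_le_R K hK) hn₁ hE₂ hE₃ (hRR K hK) (h29 K hK) hL1 _ _ _ (hinj K hK) jhalf τ hτ,
    priceM' := fun K t _ hK τ hτ =>
      priceM_of_reading_w ℛ (hN K hK) (hRm K hK) (hRmS K hK) (hRm2 K hK) (hD K hK) hL0' hL4' (hdrop' K hK)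
        (one_le_R K hK) hn₁ hE₂ hE₃ (hRR' K hK) (h29 K hK) hL1 _ _ _ (hinj K hK) jhalf τ hτ,
    -- D-50-2′: the numerator reading AT THE LEDGER's WEIGHT, the ledger's plug DISPLAYED by the record (part 2)
    upM := fun K t ht hK =>
      upM_of_reading'_of_plug ℛ Φf μ RA hR hK ht (hN K hK) (hRm K hK) (hRmS K hK) (hRm2 K hK) (hD K hK) hL0' hL4'
        (hdrop' K hK) (one_le_R K hK) hn₁ (wV K) (hplug K hK) (hF K hK) (hWpos K) _ _ (hinj K hK) jhalf,
    deadM_nonneg := fun K t _ hK =>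
      deadM_nonneg_of_reading ℛ Φf (hF K hK).fB_nonneg (hF K hK).fR_nonneg (hWpos K).le t _ _ jhalf,
    resumM := fun K t ht hK => resumM_of_reading ℛ Φf (hWpos K) t _ _ jhalf (φB K) (φR K) (hρ K t ht hK),
    FM_nonneg := fun K t _ _ => FM_nonneg_of_reading ℛ C K (ℛ.R K) _ _ _ _ jhalf,
    -- D-50-2′: run B's display `upB` is booked at `2^{d+3}`; the heavier weight `wV K` is served by monotonicity
    upM' := fun K t ht hK k hk =>
      upM'_of_trunc (fun K k => LIVEOf C K (ℛ.R K) (fun m => wV K * Real.log (Φf.Λ K m))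
        (sharpT (sB' K) (sR' K)) k) mup (hupB K t ht hK k hk),
    deadM'_nonneg := fun K t ht hK k hk => deadM'_nonneg_of_trunc (deadB_nonneg K t ht hK k hk),
    resumM' := fun K t ht hK k hk =>
      resumM'_of_trunc (fun K k => MULTOf (sharpT (φB' K) (φR' K)) k) (resumB K t ht hK k hk),
    FM'_nonneg := fun K t _ _ => FM_nonneg_of_reading ℛ C K (ℛ.R K) _ _ _ _ jhalf,
    shell := shell, budget := budget, sum_r := sum_r, sum_u := sum_u, sum_s := sum_s, sum_s₂ := sum_s₂ }⟩

end Assembly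

/-! ## §2 The M5-2c instance: `HistReadDataL.toLP` and L5 §1 RE-DERIVED through the plug road -/

section Embed

variable {F : T4Family} {G : Type*} [GaugeGroup G] [MeasurableSpace G] [HaarData G] [RegularGaugeGroup G]
  {D : FiniteEpsData F G} {C : T4PrintedShapeBanking.Consts} {O : PrintedO1s} {θv : ℝ} {rr d n : ℕ} {hn : 0 < n}
  {g₀ : ℕ → ℝ} {os : List (ULoop F)} {DomK : ℕ → Type} {I : (K : ℕ) → HIndex (DomK K)} [DecidableEq (HIndex.Idx I)]
  {DomK' : ℕ → Type} {I' : (K : ℕ) → HIndex (DomK' K)} {Xs : ℕ → Type} [∀ K, MeasurableSpace (Xs K)]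
  {μ : (K : ℕ) → Measure (Xs K)} [∀ K, IsFiniteMeasure (μ K)] {𝒢 : (K : ℕ) → GoodClass (Xs K)} {Y : ℕ → Type}
  [∀ K, MeasurableSpace (Y K)] {νB : (K : ℕ) → Measure (Y K)} [∀ K, IsFiniteMeasure (νB K)] {𝒢' : (K : ℕ) → GoodClass (Y K)}

omit [RegularGaugeGroup G] in
/-- **THE M5-2c PLUG OF AN L RECORD, per term**: `HistReadDataL`'s seven volume displays (growth `Lu K` over the lag `jl K`,
the flat lag multiplicity `huΦ`, the `E₂`∕`E₃` calibrations) DISCHARGE the plug at weight `2^{d+3}` on every term of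
`termSet I K` (`B16HistoryWeightPlugW.plug_of_flat` on the term's run, read off its history choice). [folklore] -/
theorem plug_of_histReadingL (X : HistReadDataL D C O θv rr d n hn g₀ os I I' Xs μ 𝒢 Y νB 𝒢') :
    ∀ K, X.K₀ ≤ K → ∀ τ ∈ HIndex.termSet I K, ∀ x ∈ (X.ℛ.inputOf.run K τ).histV.comp K,
      Real.exp (treeVol X.ℛ.L (X.ℛ.s K) (fun v => (v : ℝ)) (X.ℛ.inputOf.run K τ).pedMV (fun j => Real.log (X.Φf.Λ K j)) K
          (K, x)) ≤
        Real.exp (lifeCost (dictWT Prod.fst (X.ℛ.R K) C.n₁) (costT Prod.fst C K (X.ℛ.R K))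
            ((X.ℛ.inputOf.run K τ).pedMV.genT (K, x))) *
          Real.exp (birthWT Prod.fst (fun m => 2 ^ (d + 3) * Real.log (X.Φf.Λ K m))
            ((X.ℛ.inputOf.run K τ).pedMV.genT (K, x))) := by
  intro K hK τ hτ
  obtain ⟨⟨a, h, l, c⟩, -, hpe⟩ := Finset.mem_map.mp hτ
  have hτe : τ = ⟨K, a, (h, l, c)⟩ := hpe.symm
  subst hτe
  have hL0 : 0 < X.ℛ.L := by rw [X.hL]; exact lt_of_lt_of_le (by norm_num) (two_le_L F)
  have hL4 : 4 ≤ X.ℛ.L := by rw [X.hL]; exact X.hL4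
  have hdrop : ∀ m, DropCtl (X.ℛ.s K) m := by rw [X.hs]; exact X.hdrop K hK
  simp only [HistReading.run_inputOf]
  exact plug_of_flat (I := X.ℛ.runOf K a (h, l, c)) (C := C) (X.hN K hK _ hτ) (X.hRm K hK _ hτ) (X.hRmS K hK _ hτ)
    (X.hRm2 K hK _ hτ) (X.hD K hK _ hτ) hL0 hL4 hdrop (X.one_le_R K hK) X.hn₁ X.hE₂.le X.hE₃
    (fun j => X.Φf.one_le_Λ K j) (X.hLu0 K hK) (X.hj1 K hK) (X.hLu K hK) (X.hsmall K hK) (X.huΦ K hK) (X.huE₂ K hK)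
    (X.huE₃ K hK)

omit [RegularGaugeGroup G] in
/-- **THE EMBEDDING OF THE OWNER's L4 RECORD INTO THE PLUG RECORD** (M5-2c instance): every field copied but the ten volume
fields, which become `wV := 2^{d+3}`, `hwV := le_rfl`, `hplug := plug_of_histReadingL`; `huV` verbatim.  Declared INTO
`HistReadDataL`'s namespace so that `X.toLP` resolves by dot notation. [folklore] -/
def _root_.Summit.QuantumFields.BalabanUV.T4Continuum.HistoryRealiseCellsRunAssemblyWTVSDataL.HistReadDataL.toLP
    (X : HistReadDataL D C O θv rr d n hn g₀ os I I' Xs μ 𝒢 Y νB 𝒢') :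
    HistReadDataLP D C O θv rr d n hn g₀ os I I' Xs μ 𝒢 Y νB 𝒢' :=
  { l₀ := X.l₀, vol := X.vol, l₀_pos := X.l₀_pos, vol_pos := X.vol_pos, K₀ := X.K₀, RA := X.RA, ρA := X.ρA,
    holdsA := X.holdsA, intA := X.intA, H2A := X.H2A, ℛ := X.ℛ, hL := X.hL, hs := X.hs, Φf := X.Φf, hR := X.hR,
    isRj := X.isRj, one_le_R := X.one_le_R, hL4 := X.hL4, hprof := X.hprof, hdrop := X.hdrop, hN := X.hN,
    hRm := X.hRm, hRmS := X.hRmS, hRm2 := X.hRm2, hD := X.hD, hreg := X.hreg, hn₁ := X.hn₁, hE₂ := X.hE₂, hE₃ := X.hE₃,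
    wV := fun _ => 2 ^ (d + 3), hwV := fun _ _ => le_rfl, hplug := plug_of_histReadingL X,
    sB := X.sB, sR := X.sR, φB := X.φB, φR := X.φR, β' := X.β', β₀ := X.β₀,
    hF := X.hF, hRR := X.hRR, h29 := X.h29, huV := X.huV, W := X.W, one_le_W := X.one_le_W, Wi := X.Wi, BAi := X.BAi,
    mi := X.mi, hWi := X.hWi, hBA := X.hBA, hmi := X.hmi, hρ := X.hρ, c₀ := X.c₀, n₁ := X.n₁, c₀_pos := X.c₀_pos,
    floor := X.floor, floor' := X.floor', sites := X.sites, sites' := X.sites', RB := X.RB, ρB := X.ρB,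
    holdsB := X.holdsB, intB := X.intB, H2B := X.H2B, trunc := X.trunc, htr := X.htr, dB := X.dB, mup := X.mup,
    sB' := X.sB', φB' := X.φB', sR' := X.sR', φR' := X.φR', hRR' := X.hRR', upB := X.upB,
    deadB_nonneg := X.deadB_nonneg, resumB := X.resumB, mup_bd := X.mup_bd, shA := X.shA, shB := X.shB, Wsh := X.Wsh,
    shell := X.shell, Cc := X.Cc, Rr := X.Rr, CcRec := X.CcRec, RrRec := X.RrRec, ν := X.ν, u := X.u, s₂ := X.s₂,
    q₀ := X.q₀, r := X.r, s := X.s, budget := X.budget, sum_r := X.sum_r, sum_u := X.sum_u, sum_s := X.sum_s,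
    sum_s₂ := X.sum_s₂ }

omit [RegularGaugeGroup G] in
/-- the embedding keeps the reading, the threshold, the factor data and the truncation (§1's carriers unchanged) [folklore] -/
theorem _root_.Summit.QuantumFields.BalabanUV.T4Continuum.HistoryRealiseCellsRunAssemblyWTVSDataL.HistReadDataL.toLP_data
    (X : HistReadDataL D C O θv rr d n hn g₀ os I I' Xs μ 𝒢 Y νB 𝒢') :
    X.toLP.ℛ = X.ℛ ∧ X.toLP.K₀ = X.K₀ ∧ X.toLP.Φf = X.Φf ∧ X.toLP.l₀ = X.l₀ ∧ X.toLP.trunc = X.trunc ∧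
      X.toLP.wV = fun _ => 2 ^ (d + 3) :=
  ⟨rfl, rfl, rfl, rfl, rfl, rfl⟩

omit [RegularGaugeGroup G] in
/-- **L5 §1 RE-DERIVED THROUGH THE PLUG ROAD** (consistency, by the kernel): the statement of
`HistoryRealiseCellsRunAssemblyWTVSL.nonempty_countRoadWitnessT3bWTVSL_of_histReadingL` obtained as §1 ∘ `toLP` — the plug road is
a CONSERVATIVE generalisation of L4∕L5. [folklore] -/
theorem nonempty_countRoadWitnessT3bWTVSL_of_histReadingL_viaLP (X : HistReadDataL D C O θv rr d n hn g₀ os I I' Xs μ 𝒢 Y νB 𝒢') :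
    Nonempty (CountRoadWitnessT3bWTVSL D C O θv rr d n hn g₀ os (HIndex.Idx I) (ℕ × Lab d) (Lab d)) :=
  nonempty_countRoadWitnessT3bWTVSL_of_histReadingLP X.toLP

end Embed

/-! ## §3 The terminal theorem over the plug record -/

section SU

variable {F : T4Family} {N : ℕ} [NeZero N] {ℰ : LoopAverage (Matrix.specialUnitaryGroup (Fin N) ℂ)}

/-- **THE HEADLINE PREDICATE FROM A PLUG-RECORD READING OF (1.72), OVER THE REPAIRED END v3.1** (L5 §2's binders with
`HistReadDataL ↦ HistReadDataLP`): `T4ContinuumYM4Torus.ContinuumYM4Torus D`, CONDITIONAL on everything the record displays —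
in particular on the volume plug at the record's weight, which the embeddings discharge from M5-2c (`toLP`), M5-2d or
M5-2e (part 5).  NE7b NOT proved; count 0∕9. [folklore] -/
theorem continuumYM4Torus_of_histReadingLP_fsc (D : FiniteEpsData F (Matrix.specialUnitaryGroup (Fin N) ℂ))
    (hBA : D.IsBlockAveraged ℰ) (hE : ℰ.MeasurableE)
    (hB : B16.EndStatementBPrinted D.C) (hβ : BetaPertHyp D.βfun) (hsign : B16.SignConventions D.C)
    {C : T4PrintedShapeBanking.Consts} {O : PrintedO1s}
    {rr : ℕ} {β₀ : ℝ} (h : ThresholdOK C F.L rr β₀) (hμ : 0 < C.μ) (d n : ℕ)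
    (hκ₁ : (d : ℝ) * Real.log F.L + 2 * Real.log 2 ≤ C.κ₁) (hE₀ : Real.log (2 + birthMass C) ≤ C.E₀)
    (hA₀ : 1 ≤ C.A₀) (hβ₀ : 0 < β₀) (hLβ : (F.L : ℝ) * β₀ ≤ 1) (hn₁ : 13 ≤ C.n₁) (hn : 0 < n)
    {θ θv : ℝ} (hθ : 0 < θ) (hslack : C.a + (θ + θv) ≤ O.γ₀ * O.A₁ ^ 2 / 2)
    (hE₂ : 0 < C.E₂) (hE₃ : 0 ≤ C.E₃) {sS : ℕ} (hsS : 1 ≤ sS)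
    (hsmall : (((2 * cth 32 1 sS + 1) ^ d : ℕ) : ℝ) * (5 : ℝ) ^ d * ((max 1 (2 * 32 + 2) : ℕ) : ℝ) ≤
      (F.L : ℝ) ^ (sS / 2) / 2)
    {θc : ℝ} (hθc0 : 0 ≤ θc) (hθc1 : θc < 1) (hθcs : 1 / 2 ≤ θc ^ sS)
    (hRead : T4ContinuumYM4Torus.ForSmallCouplings D fun g₀ => ∀ os : List (ULoop F),
        ∃ (DomK : ℕ → Type) (I : (K : ℕ) → HIndex (DomK K)) (_ : DecidableEq (HIndex.Idx I)) (DomK' : ℕ → Type)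
          (I' : (K : ℕ) → HIndex (DomK' K)) (X : ℕ → Type) (_ : ∀ K, MeasurableSpace (X K))
          (μ : (K : ℕ) → Measure (X K)) (_ : ∀ K, IsFiniteMeasure (μ K)) (𝒢 : (K : ℕ) → GoodClass (X K))
          (Y : ℕ → Type) (_ : ∀ K, MeasurableSpace (Y K)) (νB : (K : ℕ) → Measure (Y K))
          (_ : ∀ K, IsFiniteMeasure (νB K)) (𝒢' : (K : ℕ) → GoodClass (Y K)),
          Nonempty (HistReadDataLP D C O θv rr d n hn g₀ os I I' X μ 𝒢 Y νB 𝒢')) :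
    T4ContinuumYM4Torus.ContinuumYM4Torus D :=
  continuumYM4Torus_of_countRoadT3bPWTVSL_fsc D hBA hE hB hβ hsign h hμ d n hκ₁ hE₀ hA₀ hβ₀ hLβ hn₁ hn hθ hslack hE₂ hE₃
    hsS hsmall hθc0 hθc1 hθcs
    (hRead.mono fun g₀ hg os => by
      obtain ⟨DomK, I, iI, DomK', I', X, mX, μ, hμf, 𝒢, Y, mY, νB, hνf, 𝒢', ⟨Dd⟩⟩ := hg os
      exact ⟨HIndex.Idx I, ℕ × Lab d, Lab d, iI, inferInstance, inferInstance,
        nonempty_countRoadWitnessT3bWTVSL_of_histReadingLP Dd⟩)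


end SU

end

end Summit.QuantumFields.BalabanUV.T4Continuum.HistoryRealiseCellsRunAssemblyWTVSLP
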